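import Literature.Analysis.FluidPDE.SawtoothCascade
import HarnessLib

/-!
# K1loc, line `Spectral` — S-D (first good piece): THE BACKWARD CASCADE MAP IS AFFINE ON GOOD PAIRS (itinerary Jacobian)

Helper file of the prover lane on the crux `K1LocalisedCascade` (stmt-AnomalousDissipation-19491), route
`SawtoothPulseCascade`, registered line `Cruxes.K1LocalisedCascade.Spectral` (one open stub `stub_highModeConcentration`).
Channels (S)/(L) of the analytic first good piece (memo v8 §1): the inviscid iterate is `a_n = datum ∘ Ψ_n` with the planar
backward map `Ψ_n = P₀ ∘ P₁ ∘ ⋯ ∘ P_{n−1}`, one factor per phase, `P_j = S_{H,j} ∘ S_{V,j}`,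
`S_{V,j}(z) = (z₀, z₁ − γU_j(z₀))`, `S_{H,j}(w) = (w₀ − γU_j(w₁), w₁)` (lifts of `shearMap 1 0 (γ•U_j)`, `shearMap 0 1 (γ•U_j)`).
Call a pair of backward trajectories `z, z' : ℕ → ℝ²` (`z j = P_j (z (j+1))`) GOOD if at every phase `j < n` the V-stage inputs
`z (j+1)₀, z' (j+1)₀` lie in ONE flat component `[aV j, bV j]` of `U_j` (sign `σV j`, affine defect `η j`:
`|U_j x − U_j x' − σ(x − x')| ≤ η|x − x'|`, the conclusion of `…K1Start.abs_U_sub_U_sub_le`) and the H-stage inputs likewise in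
`[aH j, bH j]` (sign `σH j`).  Then (this file, `norm_sub_sub_itinJac_mulVec_le`):

  `‖(z' 0 − z 0) − itinJac γ L *ᵥ (z' n − z n)‖_∞ ≤ Σ_{j<n} (1 + γ + γ²)^j · (γ² ℓV_j + γ ℓH_j) · η_j`,

`L = [(−σH 0, −σV 0), …, (−σH (n−1), −σV (n−1))]` the itinerary, `itinJac γ L = Π A(−σH_j, −σV_j)` the tree's pulse-pair cocycle
(`SawtoothCascade.itinJac`, Part 7), `ℓ = b − a` the flat lengths.  In particular along a horizontal chord `z' n − z n = s e₀` the
phase `Φ_n = (Ψ_n)₀` is affine with slope `k = (itinJac γ L) 0 0`, and `|k| ≥ (γ² − 3)^n` for `γ² ≥ 8` (`itinJac_growth_two`):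
`abs_phase_sub_affine_le`.  Everything is stated for arbitrary profiles `U_j : ℝ → ℝ` (no cascade import beyond Part 7).

WHAT THIS IS NOT: no statement about which pairs are good (the cell structure) nor about the iterate on `𝕋²`; planar bookkeeping only.
[cite: ElgindiLissMattingly2025, §1.2.2 (∇T^N = Π A_{j_i}; the cocycle is piecewise constant off the corner strips)] [problem: turb]
-/

-- `Summit.<Summit>.<Problem>`: single-conjunct summit, the duplicate namespace segment is deliberate.
set_option linter.dupNamespace false

noncomputable section

namespace Summit.AnomalousDissipation.AnomalousDissipation.Theorems.SawtoothPulseCascade.K1Start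

open Set Matrix
open Literature.Analysis.FluidPDE.SawtoothCascade

/-! ## §1 Sup-norm bounds for the pulse-pair cocycle -/

/-- `itinJac γ (L ++ [p]) = itinJac γ L · A(p)` (appending a phase on the inside). [cite: ElgindiLissMattingly2025, §1.2.2] -/
theorem itinJac_append_pair (γ : ℝ) (L : List (ℝ × ℝ)) (p : ℝ × ℝ) :
    itinJac γ (L ++ [p]) = itinJac γ L * pulseJac γ p.1 p.2 := by
  induction L with
  | nil => simp [itinJac]
  | cons q L ih => simp [itinJac, ih, mul_assoc]

/-- Sup-norm bound of one pulse-pair Jacobian: `‖A(r,s) v‖_∞ ≤ (1 + γ + γ²) ‖v‖_∞` for `|r|, |s| ≤ 1`, `γ ≥ 0`.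
[cite: ElgindiLissMattingly2025, §1.2.2 (the matrices A₁–A₄)] -/
theorem norm_pulseJac_mulVec_le {γ r s : ℝ} (hγ : 0 ≤ γ) (hr : |r| ≤ 1) (hs : |s| ≤ 1) (v : Fin 2 → ℝ) :
    ‖pulseJac γ r s *ᵥ v‖ ≤ (1 + γ + γ ^ 2) * ‖v‖ := by
  have h0 : |v 0| ≤ ‖v‖ := by simpa [Real.norm_eq_abs] using norm_le_pi_norm v 0
  have h1 : |v 1| ≤ ‖v‖ := by simpa [Real.norm_eq_abs] using norm_le_pi_norm v 1
  have hv : 0 ≤ ‖v‖ := norm_nonneg _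
  rw [pulseJac_mulVec]
  refine (pi_norm_le_iff_of_nonneg (by positivity)).2 fun i => ?_
  fin_cases i
  · simp only [Real.norm_eq_abs, Fin.zero_eta, cons_val_zero]
    calc |(1 + r * s * γ ^ 2) * v 0 + r * γ * v 1| ≤ |(1 + r * s * γ ^ 2) * v 0| + |r * γ * v 1| := abs_add_le _ _
      _ = |1 + r * s * γ ^ 2| * |v 0| + |r| * γ * |v 1| := by rw [abs_mul, abs_mul, abs_mul, abs_of_nonneg hγ]
      _ ≤ (1 + γ ^ 2) * ‖v‖ + 1 * γ * ‖v‖ := by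
          have hrs : |1 + r * s * γ ^ 2| ≤ 1 + γ ^ 2 := by
            calc |1 + r * s * γ ^ 2| ≤ |1| + |r * s * γ ^ 2| := abs_add_le _ _
              _ = 1 + |r| * |s| * γ ^ 2 := by rw [abs_one, abs_mul, abs_mul, abs_of_nonneg (sq_nonneg γ)]
              _ ≤ 1 + 1 * 1 * γ ^ 2 := by gcongr
              _ = 1 + γ ^ 2 := by ring
          gcongr
      _ = (1 + γ + γ ^ 2) * ‖v‖ := by ring
  · simp only [Real.norm_eq_abs, Fin.mk_one, cons_val_one]
    calc |s * γ * v 0 + v 1| ≤ |s * γ * v 0| + |v 1| := abs_add_le _ _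
      _ = |s| * γ * |v 0| + |v 1| := by rw [abs_mul, abs_mul, abs_of_nonneg hγ]
      _ ≤ 1 * γ * ‖v‖ + ‖v‖ := by gcongr
      _ ≤ (1 + γ + γ ^ 2) * ‖v‖ := by nlinarith [sq_nonneg γ]

/-- Sup-norm bound of the cocycle: `‖(Π A) v‖_∞ ≤ (1 + γ + γ²)^{|L|} ‖v‖_∞` for sign lists. [cite: ElgindiLissMattingly2025, §1.2.2] -/
theorem norm_itinJac_mulVec_le {γ : ℝ} (hγ : 0 ≤ γ) {L : List (ℝ × ℝ)} (hL : IsSignList L) (v : Fin 2 → ℝ) :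
    ‖itinJac γ L *ᵥ v‖ ≤ (1 + γ + γ ^ 2) ^ L.length * ‖v‖ := by
  induction L generalizing v with
  | nil => simp [itinJac]
  | cons p L ih =>
    have hp := hL p (by simp)
    have hL' : IsSignList L := fun q hq => hL q (List.mem_cons_of_mem _ hq)
    have hr : |p.1| ≤ 1 := by rcases hp.1 with h | h <;> rw [h] <;> norm_num
    have hs : |p.2| ≤ 1 := by rcases hp.2 with h | h <;> rw [h] <;> norm_num
    rw [itinJac, ← mulVec_mulVec, List.length_cons, pow_succ']
    calc ‖pulseJac γ p.1 p.2 *ᵥ (itinJac γ L *ᵥ v)‖ ≤ (1 + γ + γ ^ 2) * ‖itinJac γ L *ᵥ v‖ :=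
          norm_pulseJac_mulVec_le hγ hr hs _
      _ ≤ (1 + γ + γ ^ 2) * ((1 + γ + γ ^ 2) ^ L.length * ‖v‖) :=
          mul_le_mul_of_nonneg_left (ih hL' v) (by positivity)
      _ = (1 + γ + γ ^ 2) * (1 + γ + γ ^ 2) ^ L.length * ‖v‖ := by ring

/-! ## §2 One phase: the backward pulse pair is affine on a good pair up to `(γ² ℓV + γ ℓH) η` -/

/-- **One backward phase on a good pair.**  Let `U : ℝ → ℝ`, `γ ≥ 1`, and two input points `p, p' ∈ ℝ²` with
`p₀, p'₀ ∈ [aV, bV]` where `|U x − U x' − σV (x − x')| ≤ η|x − x'|` (`|σV| = 1`), and with the V-outputs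
`q₁ = p₁ − γU(p₀)`, `q'₁` in `[aH, bH]` where `|U x − U x' − σH(x − x')| ≤ η|x − x'|` (`|σH| = 1`).  Then the backward pulse pair
`P(p) = (p₀ − γU(p₁ − γU(p₀)), p₁ − γU(p₀))` satisfies
`‖P(p') − P(p) − A(−σH, −σV)(p' − p)‖_∞ ≤ (γ²(bV − aV) + γ(bH − aH)) η`. [cite: ElgindiLissMattingly2025, §1.2.2] -/
theorem norm_phaseBack_sub_pulseJac_mulVec_le (U : ℝ → ℝ) {γ σH σV η aV bV aH bH : ℝ} (hγ : 1 ≤ γ) (hη : 0 ≤ η)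
    (hσH : σH = 1 ∨ σH = -1) (hσV : σV = 1 ∨ σV = -1)
    (hUV : ∀ x ∈ Icc aV bV, ∀ x' ∈ Icc aV bV, |U x - U x' - σV * (x - x')| ≤ η * |x - x'|)
    (hUH : ∀ x ∈ Icc aH bH, ∀ x' ∈ Icc aH bH, |U x - U x' - σH * (x - x')| ≤ η * |x - x'|)
    {p p' q q' o o' : Fin 2 → ℝ} (hp : p 0 ∈ Icc aV bV) (hp' : p' 0 ∈ Icc aV bV)
    (hq0 : q 0 = p 0) (hq1 : q 1 = p 1 - γ * U (p 0)) (hq0' : q' 0 = p' 0) (hq1' : q' 1 = p' 1 - γ * U (p' 0))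
    (hq : q 1 ∈ Icc aH bH) (hq' : q' 1 ∈ Icc aH bH)
    (ho0 : o 0 = q 0 - γ * U (q 1)) (ho1 : o 1 = q 1) (ho0' : o' 0 = q' 0 - γ * U (q' 1)) (ho1' : o' 1 = q' 1) :
    ‖(o' - o) - pulseJac γ (-σH) (-σV) *ᵥ (p' - p)‖ ≤ (γ ^ 2 * (bV - aV) + γ * (bH - aH)) * η := by
  have hγ0 : 0 ≤ γ := by linarith
  -- the two slope defects
  set eV : ℝ := U (p' 0) - U (p 0) - σV * (p' 0 - p 0) with heV
  set eH : ℝ := U (q' 1) - U (q 1) - σH * (q' 1 - q 1) with heH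
  have heVb : |eV| ≤ η * (bV - aV) := by
    refine (hUV _ hp' _ hp).trans (mul_le_mul_of_nonneg_left ?_ hη)
    rw [abs_le]; constructor <;> linarith [hp.1, hp.2, hp'.1, hp'.2]
  have heHb : |eH| ≤ η * (bH - aH) := by
    refine (hUH _ hq' _ hq).trans (mul_le_mul_of_nonneg_left ?_ hη)
    rw [abs_le]; constructor <;> linarith [hq.1, hq.2, hq'.1, hq'.2]
  have hsH : |σH| = 1 := by rcases hσH with h | h <;> rw [h] <;> norm_num
  have hsV2 : σV * σV = 1 := by rcases hσV with h | h <;> rw [h] <;> norm_num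
  -- componentwise identities
  have hJ0 : (pulseJac γ (-σH) (-σV) *ᵥ (p' - p)) 0 = (1 + (-σH) * (-σV) * γ ^ 2) * (p' 0 - p 0) + (-σH) * γ * (p' 1 - p 1) := by
    rw [pulseJac_mulVec]; simp
  have hJ1 : (pulseJac γ (-σH) (-σV) *ᵥ (p' - p)) 1 = (-σV) * γ * (p' 0 - p 0) + (p' 1 - p 1) := by
    rw [pulseJac_mulVec]; simp
  have hUp : U (p' 0) - U (p 0) = σV * (p' 0 - p 0) + eV := by rw [heV]; ring
  have hUq : U (q' 1) - U (q 1) = σH * (q' 1 - q 1) + eH := by rw [heH]; ring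
  have hdq1 : q' 1 - q 1 = (p' 1 - p 1) - γ * (σV * (p' 0 - p 0) + eV) := by rw [hq1, hq1', ← hUp]; ring
  have e1 : (o' - o - pulseJac γ (-σH) (-σV) *ᵥ (p' - p)) 1 = -(γ * eV) := by
    rw [Pi.sub_apply, Pi.sub_apply, hJ1, ho1, ho1', hdq1]; ring
  have e0 : (o' - o - pulseJac γ (-σH) (-σV) *ᵥ (p' - p)) 0 = γ ^ 2 * σH * eV - γ * eH := by
    rw [Pi.sub_apply, Pi.sub_apply, hJ0, ho0, ho0', hq0, hq0']
    have : γ * U (q' 1) - γ * U (q 1) = γ * (σH * (q' 1 - q 1) + eH) := by rw [← hUq]; ring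
    linear_combination (-1 : ℝ) * this + (-(γ * σH)) * hdq1
  have hℓV : 0 ≤ bV - aV := by linarith [hp.1, hp.2]
  have hℓH : 0 ≤ bH - aH := by linarith [hq.1, hq.2]
  have hB : 0 ≤ (γ ^ 2 * (bV - aV) + γ * (bH - aH)) * η := by positivity
  refine (pi_norm_le_iff_of_nonneg hB).2 fun i => ?_
  fin_cases i
  · simp only [Fin.zero_eta, Real.norm_eq_abs]
    rw [e0]
    calc |γ ^ 2 * σH * eV - γ * eH| ≤ |γ ^ 2 * σH * eV| + |γ * eH| := abs_sub _ _
      _ = γ ^ 2 * |eV| + γ * |eH| := by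
          rw [abs_mul, abs_mul, abs_mul, hsH, abs_of_nonneg hγ0, abs_of_nonneg (sq_nonneg γ), mul_one]
      _ ≤ γ ^ 2 * (η * (bV - aV)) + γ * (η * (bH - aH)) := by gcongr
      _ = (γ ^ 2 * (bV - aV) + γ * (bH - aH)) * η := by ring
  · simp only [Fin.mk_one, Real.norm_eq_abs]
    rw [e1, abs_neg, abs_mul, abs_of_nonneg hγ0]
    calc γ * |eV| ≤ γ * (η * (bV - aV)) := mul_le_mul_of_nonneg_left heVb hγ0
      _ ≤ γ ^ 2 * (η * (bV - aV)) := by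
          refine mul_le_mul_of_nonneg_right (by nlinarith) (mul_nonneg hη hℓV)
      _ ≤ (γ ^ 2 * (bV - aV) + γ * (bH - aH)) * η := by nlinarith [mul_nonneg hη hℓH]

/-! ## §3 `n` phases: the backward map is affine on good pairs with linear part the itinerary Jacobian -/

/-- **The backward cascade map on a good pair of trajectories.**  Profiles `U j : ℝ → ℝ`, `γ ≥ 1`; signs `σH j, σV j = ±1`;
flat components `[aV j, bV j]`, `[aH j, bH j]` with affine defects `η j ≥ 0`; two backward trajectories `z, z'` and their
V-outputs `w, w'` (`w j = S_{V,j}(z (j+1))`, `z j = S_{H,j}(w j)`, componentwise) whose stage inputs lie in the flat components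
for every `j < n`.  Then with the itinerary `L = [(−σH 0, −σV 0), …, (−σH (n−1), −σV (n−1))]`:
`‖(z' 0 − z 0) − itinJac γ L *ᵥ (z' n − z n)‖_∞ ≤ Σ_{j<n} (1+γ+γ²)^j (γ²(bV j − aV j) + γ(bH j − aH j)) η j`.
[cite: ElgindiLissMattingly2025, §1.2.2 (∇T^N = Π A_{j_i} off the corner strips)] -/
theorem norm_sub_sub_itinJac_mulVec_le (U : ℕ → ℝ → ℝ) {γ : ℝ} (hγ : 1 ≤ γ) (σH σV η aV bV aH bH : ℕ → ℝ)
    (hη : ∀ j, 0 ≤ η j) (hσH : ∀ j, σH j = 1 ∨ σH j = -1) (hσV : ∀ j, σV j = 1 ∨ σV j = -1)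
    (hUV : ∀ j, ∀ x ∈ Icc (aV j) (bV j), ∀ x' ∈ Icc (aV j) (bV j), |U j x - U j x' - σV j * (x - x')| ≤ η j * |x - x'|)
    (hUH : ∀ j, ∀ x ∈ Icc (aH j) (bH j), ∀ x' ∈ Icc (aH j) (bH j), |U j x - U j x' - σH j * (x - x')| ≤ η j * |x - x'|)
    (z z' w w' : ℕ → Fin 2 → ℝ)
    (hw0 : ∀ j, w j 0 = z (j + 1) 0) (hw1 : ∀ j, w j 1 = z (j + 1) 1 - γ * U j (z (j + 1) 0))
    (hw0' : ∀ j, w' j 0 = z' (j + 1) 0) (hw1' : ∀ j, w' j 1 = z' (j + 1) 1 - γ * U j (z' (j + 1) 0))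
    (hz0 : ∀ j, z j 0 = w j 0 - γ * U j (w j 1)) (hz1 : ∀ j, z j 1 = w j 1)
    (hz0' : ∀ j, z' j 0 = w' j 0 - γ * U j (w' j 1)) (hz1' : ∀ j, z' j 1 = w' j 1)
    (n : ℕ) (hgoodV : ∀ j < n, z (j + 1) 0 ∈ Icc (aV j) (bV j) ∧ z' (j + 1) 0 ∈ Icc (aV j) (bV j))
    (hgoodH : ∀ j < n, w j 1 ∈ Icc (aH j) (bH j) ∧ w' j 1 ∈ Icc (aH j) (bH j)) :
    ‖(z' 0 - z 0) - itinJac γ ((List.range n).map fun j => (-σH j, -σV j)) *ᵥ (z' n - z n)‖ ≤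
      ∑ j ∈ Finset.range n, (1 + γ + γ ^ 2) ^ j * ((γ ^ 2 * (bV j - aV j) + γ * (bH j - aH j)) * η j) := by
  have hγ0 : 0 ≤ γ := by linarith
  induction n with
  | zero => simp [itinJac]
  | succ n ih =>
    have ih' := ih (fun j hj => hgoodV j (hj.trans n.lt_succ_self)) (fun j hj => hgoodH j (hj.trans n.lt_succ_self))
    -- the innermost phase `n`
    have hstep := norm_phaseBack_sub_pulseJac_mulVec_le (U n) hγ (hη n) (hσH n) (hσV n) (hUV n) (hUH n)
      (p := z (n + 1)) (p' := z' (n + 1)) (q := w n) (q' := w' n) (o := z n) (o' := z' n)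
      (hgoodV n n.lt_succ_self).1 (hgoodV n n.lt_succ_self).2 (hw0 n) (hw1 n) (hw0' n) (hw1' n)
      (hgoodH n n.lt_succ_self).1 (hgoodH n n.lt_succ_self).2 (hz0 n) (hz1 n) (hz0' n) (hz1' n)
    -- the itinerary grows by one pair on the inside
    have hL : (List.range (n + 1)).map (fun j => (-σH j, -σV j)) =
        (List.range n).map (fun j => (-σH j, -σV j)) ++ [(-σH n, -σV n)] := by
      rw [List.range_succ, List.map_append, List.map_singleton]
    have hsign : IsSignList ((List.range n).map fun j => (-σH j, -σV j)) := by
      intro p hp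
      obtain ⟨j, -, rfl⟩ := List.mem_map.1 hp
      refine ⟨?_, ?_⟩
      · rcases hσH j with h | h <;> simp [h]
      · rcases hσV j with h | h <;> simp [h]
    have hlen : ((List.range n).map fun j => (-σH j, -σV j)).length = n := by simp
    rw [hL, itinJac_append_pair, ← mulVec_mulVec, Finset.sum_range_succ]
    -- split the defect
    have hsplit : (z' 0 - z 0) - itinJac γ ((List.range n).map fun j => (-σH j, -σV j)) *ᵥ
          (pulseJac γ (-σH n) (-σV n) *ᵥ (z' (n + 1) - z (n + 1))) =
        ((z' 0 - z 0) - itinJac γ ((List.range n).map fun j => (-σH j, -σV j)) *ᵥ (z' n - z n)) +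
          itinJac γ ((List.range n).map fun j => (-σH j, -σV j)) *ᵥ
            ((z' n - z n) - pulseJac γ (-σH n) (-σV n) *ᵥ (z' (n + 1) - z (n + 1))) := by
      simp only [mulVec_sub]; abel
    rw [hsplit]
    refine (norm_add_le _ _).trans (add_le_add ih' ?_)
    calc ‖itinJac γ ((List.range n).map fun j => (-σH j, -σV j)) *ᵥ
            ((z' n - z n) - pulseJac γ (-σH n) (-σV n) *ᵥ (z' (n + 1) - z (n + 1)))‖
        ≤ (1 + γ + γ ^ 2) ^ n * ‖(z' n - z n) - pulseJac γ (-σH n) (-σV n) *ᵥ (z' (n + 1) - z (n + 1))‖ := by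
          have h := norm_itinJac_mulVec_le hγ0 hsign
            ((z' n - z n) - pulseJac γ (-σH n) (-σV n) *ᵥ (z' (n + 1) - z (n + 1)))
          rwa [hlen] at h
      _ ≤ (1 + γ + γ ^ 2) ^ n * ((γ ^ 2 * (bV n - aV n) + γ * (bH n - aH n)) * η n) :=
          mul_le_mul_of_nonneg_left hstep (by positivity)

/-! ## §4 The phase along a horizontal chord: affine with slope `(itinJac γ L)₀₀`, `|slope| ≥ (γ² − 3)^n` -/

/-- The itinerary list of a good pair is a sign list of length `n`. [folklore] -/
theorem isSignList_itinerary (σH σV : ℕ → ℝ) (hσH : ∀ j, σH j = 1 ∨ σH j = -1) (hσV : ∀ j, σV j = 1 ∨ σV j = -1)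
    (n : ℕ) : IsSignList ((List.range n).map fun j => (-σH j, -σV j)) ∧
      ((List.range n).map fun j => (-σH j, -σV j)).length = n := by
  refine ⟨fun p hp => ?_, by simp⟩
  obtain ⟨j, -, rfl⟩ := List.mem_map.1 hp
  refine ⟨?_, ?_⟩
  · rcases hσH j with h | h <;> simp [h]
  · rcases hσV j with h | h <;> simp [h]

/-- **The horizontal cell frequency.**  For a sign list `L` of length `n` and `γ² ≥ 8`: the `(0,0)` entry `k` of `itinJac γ L`
satisfies `|k| ≥ (γ² − 3)^n` (`itinJac_growth_two` applied to `e₀`, which lies in the unstable cone).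
[cite: ElgindiLissMattingly2025, §3.1 Lemma 3.1] -/
theorem abs_itinJac_entry_ge {γ : ℝ} (hγ : 0 < γ) (h8 : 8 ≤ γ ^ 2) {L : List (ℝ × ℝ)} (hL : IsSignList L) :
    (γ ^ 2 - 3) ^ L.length ≤ |itinJac γ L 0 0| := by
  have hv : γ * |(Pi.single 0 1 : Fin 2 → ℝ) 1| ≤ 2 * |(Pi.single 0 1 : Fin 2 → ℝ) 0| := by simp
  have h := (itinJac_growth_two hγ h8 hL hv).2
  simpa [Matrix.mulVec_single_one] using h

/-- **The phase along a horizontal chord of a good cell.**  Under the hypotheses of `norm_sub_sub_itinJac_mulVec_le`, if the two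
endpoints differ horizontally, `z' n − z n = s e₀`, then the phase `Φ = (z 0)₀` is affine in `s` with slope the cell frequency
`k = (itinJac γ L) 0 0`:  `|(z' 0)₀ − (z 0)₀ − k s| ≤ Σ_{j<n} (1+γ+γ²)^j (γ²ℓV_j + γℓH_j) η_j`, and `|k| ≥ (γ²−3)^n` when `γ² ≥ 8`.
[cite: ElgindiLissMattingly2025, §1.2.2, §3.1] -/
theorem abs_phase_sub_affine_le (U : ℕ → ℝ → ℝ) {γ : ℝ} (hγ : 1 ≤ γ) (σH σV η aV bV aH bH : ℕ → ℝ)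
    (hη : ∀ j, 0 ≤ η j) (hσH : ∀ j, σH j = 1 ∨ σH j = -1) (hσV : ∀ j, σV j = 1 ∨ σV j = -1)
    (hUV : ∀ j, ∀ x ∈ Icc (aV j) (bV j), ∀ x' ∈ Icc (aV j) (bV j), |U j x - U j x' - σV j * (x - x')| ≤ η j * |x - x'|)
    (hUH : ∀ j, ∀ x ∈ Icc (aH j) (bH j), ∀ x' ∈ Icc (aH j) (bH j), |U j x - U j x' - σH j * (x - x')| ≤ η j * |x - x'|)
    (z z' w w' : ℕ → Fin 2 → ℝ)
    (hw0 : ∀ j, w j 0 = z (j + 1) 0) (hw1 : ∀ j, w j 1 = z (j + 1) 1 - γ * U j (z (j + 1) 0))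
    (hw0' : ∀ j, w' j 0 = z' (j + 1) 0) (hw1' : ∀ j, w' j 1 = z' (j + 1) 1 - γ * U j (z' (j + 1) 0))
    (hz0 : ∀ j, z j 0 = w j 0 - γ * U j (w j 1)) (hz1 : ∀ j, z j 1 = w j 1)
    (hz0' : ∀ j, z' j 0 = w' j 0 - γ * U j (w' j 1)) (hz1' : ∀ j, z' j 1 = w' j 1)
    (n : ℕ) (hgoodV : ∀ j < n, z (j + 1) 0 ∈ Icc (aV j) (bV j) ∧ z' (j + 1) 0 ∈ Icc (aV j) (bV j))
    (hgoodH : ∀ j < n, w j 1 ∈ Icc (aH j) (bH j) ∧ w' j 1 ∈ Icc (aH j) (bH j))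
    {s : ℝ} (hs : z' n - z n = s • (Pi.single 0 1 : Fin 2 → ℝ)) :
    |z' 0 0 - z 0 0 - (itinJac γ ((List.range n).map fun j => (-σH j, -σV j))) 0 0 * s| ≤
      ∑ j ∈ Finset.range n, (1 + γ + γ ^ 2) ^ j * ((γ ^ 2 * (bV j - aV j) + γ * (bH j - aH j)) * η j) := by
  have h := norm_sub_sub_itinJac_mulVec_le U hγ σH σV η aV bV aH bH hη hσH hσV hUV hUH z z' w w' hw0 hw1 hw0' hw1' hz0
    hz1 hz0' hz1' n hgoodV hgoodH
  rw [hs, mulVec_smul, Matrix.mulVec_single_one] at h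
  have h0 := (norm_le_pi_norm ((z' 0 - z 0) - s • (fun i => itinJac γ ((List.range n).map fun j => (-σH j, -σV j)) i 0)) 0).trans h
  simpa [Real.norm_eq_abs, mul_comm] using h0

/-! ## §5 The same on a finite trajectory (recursion hypotheses only below level `n`) -/

/-- **The backward cascade map on a good pair — finite-trajectory form.**  As `norm_sub_sub_itinJac_mulVec_le`, but the recursion
hypotheses for `z, z′, w, w′` are only asked for the levels `j < n` (a backward trajectory started at level `n` need not be extended
upward).  Same conclusion. [cite: ElgindiLissMattingly2025, §1.2.2 (∇T^N = Π A_{j_i} off the corner strips)] -/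
theorem norm_sub_sub_itinJac_mulVec_le_of_lt (U : ℕ → ℝ → ℝ) {γ : ℝ} (hγ : 1 ≤ γ) (σH σV η aV bV aH bH : ℕ → ℝ)
    (hη : ∀ j, 0 ≤ η j) (hσH : ∀ j, σH j = 1 ∨ σH j = -1) (hσV : ∀ j, σV j = 1 ∨ σV j = -1)
    (hUV : ∀ j, ∀ x ∈ Icc (aV j) (bV j), ∀ x' ∈ Icc (aV j) (bV j), |U j x - U j x' - σV j * (x - x')| ≤ η j * |x - x'|)
    (hUH : ∀ j, ∀ x ∈ Icc (aH j) (bH j), ∀ x' ∈ Icc (aH j) (bH j), |U j x - U j x' - σH j * (x - x')| ≤ η j * |x - x'|)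
    (n : ℕ) (z z' w w' : ℕ → Fin 2 → ℝ)
    (hw0 : ∀ j < n, w j 0 = z (j + 1) 0) (hw1 : ∀ j < n, w j 1 = z (j + 1) 1 - γ * U j (z (j + 1) 0))
    (hw0' : ∀ j < n, w' j 0 = z' (j + 1) 0) (hw1' : ∀ j < n, w' j 1 = z' (j + 1) 1 - γ * U j (z' (j + 1) 0))
    (hz0 : ∀ j < n, z j 0 = w j 0 - γ * U j (w j 1)) (hz1 : ∀ j < n, z j 1 = w j 1)
    (hz0' : ∀ j < n, z' j 0 = w' j 0 - γ * U j (w' j 1)) (hz1' : ∀ j < n, z' j 1 = w' j 1)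
    (hgoodV : ∀ j < n, z (j + 1) 0 ∈ Icc (aV j) (bV j) ∧ z' (j + 1) 0 ∈ Icc (aV j) (bV j))
    (hgoodH : ∀ j < n, w j 1 ∈ Icc (aH j) (bH j) ∧ w' j 1 ∈ Icc (aH j) (bH j)) :
    ‖(z' 0 - z 0) - itinJac γ ((List.range n).map fun j => (-σH j, -σV j)) *ᵥ (z' n - z n)‖ ≤
      ∑ j ∈ Finset.range n, (1 + γ + γ ^ 2) ^ j * ((γ ^ 2 * (bV j - aV j) + γ * (bH j - aH j)) * η j) := by
  have hγ0 : 0 ≤ γ := by linarith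
  induction n with
  | zero => simp [itinJac]
  | succ n ih =>
    have hlt : ∀ {Q : ℕ → Prop}, (∀ j < n + 1, Q j) → ∀ j < n, Q j := fun h j hj => h j (hj.trans n.lt_succ_self)
    have ih' := ih (hlt hw0) (hlt hw1) (hlt hw0') (hlt hw1') (hlt hz0) (hlt hz1) (hlt hz0') (hlt hz1')
      (fun j hj => hgoodV j (hj.trans n.lt_succ_self)) (fun j hj => hgoodH j (hj.trans n.lt_succ_self))
    have hn : n < n + 1 := n.lt_succ_self
    have hstep := norm_phaseBack_sub_pulseJac_mulVec_le (U n) hγ (hη n) (hσH n) (hσV n) (hUV n) (hUH n)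
      (p := z (n + 1)) (p' := z' (n + 1)) (q := w n) (q' := w' n) (o := z n) (o' := z' n)
      (hgoodV n hn).1 (hgoodV n hn).2 (hw0 n hn) (hw1 n hn) (hw0' n hn) (hw1' n hn)
      (hgoodH n hn).1 (hgoodH n hn).2 (hz0 n hn) (hz1 n hn) (hz0' n hn) (hz1' n hn)
    have hL : (List.range (n + 1)).map (fun j => (-σH j, -σV j)) =
        (List.range n).map (fun j => (-σH j, -σV j)) ++ [(-σH n, -σV n)] := by
      rw [List.range_succ, List.map_append, List.map_singleton]
    have hsign : IsSignList ((List.range n).map fun j => (-σH j, -σV j)) := (isSignList_itinerary σH σV hσH hσV n).1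
    have hlen : ((List.range n).map fun j => (-σH j, -σV j)).length = n := by simp
    rw [hL, itinJac_append_pair, ← mulVec_mulVec, Finset.sum_range_succ]
    have hsplit : (z' 0 - z 0) - itinJac γ ((List.range n).map fun j => (-σH j, -σV j)) *ᵥ
          (pulseJac γ (-σH n) (-σV n) *ᵥ (z' (n + 1) - z (n + 1))) =
        ((z' 0 - z 0) - itinJac γ ((List.range n).map fun j => (-σH j, -σV j)) *ᵥ (z' n - z n)) +
          itinJac γ ((List.range n).map fun j => (-σH j, -σV j)) *ᵥ
            ((z' n - z n) - pulseJac γ (-σH n) (-σV n) *ᵥ (z' (n + 1) - z (n + 1))) := by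
      simp only [mulVec_sub]; abel
    rw [hsplit]
    refine (norm_add_le _ _).trans (add_le_add ih' ?_)
    calc ‖itinJac γ ((List.range n).map fun j => (-σH j, -σV j)) *ᵥ
            ((z' n - z n) - pulseJac γ (-σH n) (-σV n) *ᵥ (z' (n + 1) - z (n + 1)))‖
        ≤ (1 + γ + γ ^ 2) ^ n * ‖(z' n - z n) - pulseJac γ (-σH n) (-σV n) *ᵥ (z' (n + 1) - z (n + 1))‖ := by
          have h := norm_itinJac_mulVec_le hγ0 hsign
            ((z' n - z n) - pulseJac γ (-σH n) (-σV n) *ᵥ (z' (n + 1) - z (n + 1)))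
          rwa [hlen] at h
      _ ≤ (1 + γ + γ ^ 2) ^ n * ((γ ^ 2 * (bV n - aV n) + γ * (bH n - aH n)) * η n) :=
          mul_le_mul_of_nonneg_left hstep (by positivity)

end Summit.AnomalousDissipation.AnomalousDissipation.Theorems.SawtoothPulseCascade.K1Start
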